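import Summits.MatrixMultiplication.MatrixMultiplication.Theorems.SoloInformedNearRectPins

/-!
# THEOREM 8.20, Step 3.2 in threshold form: the light rows are two-classed (so a popular class always exists)

This work, §8.8 (T12)(f) Step 3.2 and C3-m2 §5.5 (gen 107). Setting as in `SoloInformedStepThree`.

In the all-L world the light rows `i ∈ Il` of `a` are `∼ α_i` on the poor family `Jp` off column sets `Ea i`
(`|Ea i| ≤ d`).
* `Data.arows_cross_typed` (8.16a in threshold form, crossed case): two rows of `a` of classes `α ≁ α′` on `Js`:
  either `n·t·|Js| ≤ r·|S⁰|` or, off `< t` columns `k`, `c(k,i₀′) ∼ α` and `c(k,i₀) ∼ α′` (only the exception X2 of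
  the two-centre lemma can occur) [`Data.card_mul_le_of_two_arows`].
* `Data.light_rows_two_classed` (STEP 3.2): either `n·t·(|Jp| − 2d) ≤ r·|S⁰|`, or the classes `α_i` (`i ∈ Il`) take
  at most TWO values up to sign: every `i′` with `α_{i′} ≁ α_{i₀}` reads its class off column `i₀` of `c`
  (`c(·,i₀) ∼ α_{i′}` off `< t` rows), and two such readings agree on a common row when `2t ≤ n`.
Consequently the "α spread" alternative 3.2 of the paper proof never needs a separate ending: a class with at least
half of the light rows always exists (or a bound holds), and Step 3.1 applies to it.
-/

namespace Summit.MatrixMultiplication.MatrixMultiplication.Theorems.TwistedTPP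

namespace FibreLines

variable {ι G : Type*} [AddCommGroup G]
variable {G₀ : Type*} [AddCommGroup G₀] {R : Type*}

/-- **8.16a IN THRESHOLD FORM, crossed classes.** [this work, §8.8 (T12)(f) Step 3.2; C3-m2 §5.5] -/
theorem Data.arows_cross_typed [Fintype ι] [DecidableEq ι] [Fintype G₀] [DecidableEq G₀] [Fintype R]
    [DecidableEq R] (hG : ∀ x : G, x = -x → x = 0) (D : Data ι G) (Φ : Chart ι G₀) (κ : G → R)
    (hκ : ∀ x y, κ x = κ y → SignEq x y) (hsep : D.SepAll Φ) {i₀ i₀' : ι} {α α' : G} (Js : Finset ι)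
    (hi : ∀ j ∈ Js, SignEq (D.a i₀ j) α) (hi' : ∀ j ∈ Js, SignEq (D.a i₀' j) α') (hαα : ¬ SignEq α α')
    (t : ℕ) :
    Fintype.card ι * t * Js.card ≤ Fintype.card R * Fintype.card G₀ ∨
      ∃ Kg : Finset ι, Fintype.card ι < Kg.card + t ∧
        ∀ k ∈ Kg, SignEq α (D.c k i₀') ∧ SignEq α' (D.c k i₀) := by
  classical
  set K₁ : Finset ι := Finset.univ.filter fun k => ¬ (SignEq α (D.c k i₀') ∧ SignEq α' (D.c k i₀)) with hK₁
  have hb := D.card_mul_le_of_two_arows hG Φ κ hκ hsep Js K₁ hi hi' (fun k _ h => hαα h.1)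
    fun k hk => (Finset.mem_filter.1 hk).2
  by_cases ht : t ≤ K₁.card
  · left
    exact (Nat.mul_le_mul_right _ (Nat.mul_le_mul_left _ ht)).trans hb
  · right
    push Not at ht
    set Kg : Finset ι := Finset.univ.filter fun k => SignEq α (D.c k i₀') ∧ SignEq α' (D.c k i₀) with hKg
    have hsplit : Kg.card + K₁.card = Fintype.card ι := by
      rw [← Finset.card_univ]; exact Finset.card_filter_add_card_filter_not _
    exact ⟨Kg, by omega, fun k hk => (Finset.mem_filter.1 hk).2⟩

/-- **STEP 3.2 IN THRESHOLD FORM: the light rows are two-classed.** [this work, §8.8 (T12)(f) Step 3.2; C3-m2 §5.5] -/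
theorem Data.light_rows_two_classed [Fintype ι] [DecidableEq ι] [Fintype G₀] [DecidableEq G₀] [Fintype R]
    [DecidableEq R] (hG : ∀ x : G, x = -x → x = 0) (D : Data ι G) (Φ : Chart ι G₀) (κ : G → R)
    (hκ : ∀ x y, κ x = κ y → SignEq x y) (hsep : D.SepAll Φ) (Il Jp : Finset ι) (αc : ι → G)
    (Ea : ι → Finset ι) (d t : ℕ)
    (hEa : ∀ i ∈ Il, (Ea i).card ≤ d ∧ ∀ j ∈ Jp, j ∉ Ea i → SignEq (D.a i j) (αc i))
    (hn : 2 * t ≤ Fintype.card ι) :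
    Fintype.card ι * t * (Jp.card - 2 * d) ≤ Fintype.card R * Fintype.card G₀ ∨
      ∃ γ γ' : G, ∀ i ∈ Il, SignEq (αc i) γ ∨ SignEq (αc i) γ' := by
  classical
  by_cases hb : Fintype.card ι * t * (Jp.card - 2 * d) ≤ Fintype.card R * Fintype.card G₀
  · exact Or.inl hb
  right
  rcases Il.eq_empty_or_nonempty with h0 | ⟨i₀, hi₀⟩
  · exact ⟨0, 0, by simp [h0]⟩
  by_cases hall : ∀ i ∈ Il, SignEq (αc i) (αc i₀)
  · exact ⟨αc i₀, αc i₀, fun i hi => Or.inl (hall i hi)⟩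
  push Not at hall
  obtain ⟨i₁, hi₁, hne₁⟩ := hall
  -- every class inequivalent to `αc i₀` is read off column `i₀` of `c`
  have key : ∀ i' ∈ Il, ¬ SignEq (αc i') (αc i₀) →
      ∃ Kg : Finset ι, Fintype.card ι < Kg.card + t ∧ ∀ k ∈ Kg, SignEq (αc i') (D.c k i₀) := by
    intro i' hi' hne
    have hJs : ∀ i'' ∈ ({i₀, i'} : Finset ι), ∀ j ∈ Jp \ (Ea i₀ ∪ Ea i'), SignEq (D.a i'' j) (αc i'') := by
      intro i'' hi'' j hj
      obtain ⟨hjp, hjE⟩ := Finset.mem_sdiff.1 hj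
      rw [Finset.mem_union, not_or] at hjE
      rcases Finset.mem_insert.1 hi'' with rfl | hi''
      · exact (hEa _ hi₀).2 j hjp hjE.1
      · rw [Finset.mem_singleton] at hi''; subst hi''
        exact (hEa _ hi').2 j hjp hjE.2
    rcases D.arows_cross_typed hG Φ κ hκ hsep (Jp \ (Ea i₀ ∪ Ea i'))
      (hJs i₀ (Finset.mem_insert_self _ _))
      (hJs i' (Finset.mem_insert_of_mem (Finset.mem_singleton_self _))) (fun h => hne h.symm) t with
      hb' | ⟨Kg, hKg, hk⟩
    · exfalso
      refine hb (le_trans (Nat.mul_le_mul_left _ ?_) hb')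
      have h1 := Finset.card_le_card_sdiff_add_card (s := Jp) (t := Ea i₀ ∪ Ea i')
      have h2 := Finset.card_union_le (Ea i₀) (Ea i')
      have h3 := (hEa i₀ hi₀).1
      have h4 := (hEa i' hi').1
      omega
    · exact ⟨Kg, hKg, fun k hk' => (hk k hk').2⟩
  obtain ⟨K₁, hK₁, hk₁⟩ := key i₁ hi₁ hne₁
  refine ⟨αc i₀, αc i₁, fun i hi => ?_⟩
  by_cases h : SignEq (αc i) (αc i₀)
  · exact Or.inl h
  right
  obtain ⟨K', hK', hk'⟩ := key i hi h
  have hne : (K₁ ∩ K').Nonempty := by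
    rw [← Finset.card_pos]
    have h1 := Finset.card_union_add_card_inter K₁ K'
    have h2 := Finset.card_le_univ (K₁ ∪ K')
    omega
  obtain ⟨k, hk⟩ := hne
  exact (hk' k (Finset.mem_inter.1 hk).2).trans (hk₁ k (Finset.mem_inter.1 hk).1).symm

end FibreLines

end Summit.MatrixMultiplication.MatrixMultiplication.Theorems.TwistedTPP
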